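import Literature.NumberTheory.EllipticCurves.TwoDescentOneRootKummerBridgeLocal
import Mathlib.RingTheory.DedekindDomain.AdicValuation
import HarnessLib

/-!
# The one-root `2`-descent map at a good odd place: `x(P) − θ` has even valuation

Cassels, *Lectures on Elliptic Curves*, §15 (p. 44: "the image of `μ` lies in the finite group of elements
of `ℚ[Θ]*/ℚ[Θ]*²` which are units outside `2Δ`") / Silverman, *AEC*, Prop. X.1.4 (`Sel ⊆ K(S, 2)`), for
ONE rational root `θ` of the `2`-division cubic. Setting: a Weierstrass curve over a field `L` carrying a
valuation `v : L → Γ₀` (a completion `K_w` of a number field), `θ ∈ L` with `Ψ₂(θ) = 0`, and the GOOD ODD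
hypotheses at `v`: `v(2) = 1`, `θ, b₂, b₄` integral, and `v(c(θ)) = 1` for Cassels' constant
`c(θ) = 3θ² + (b₂/2)θ + b₄/2 = Ψ₂'(θ)/4` (`oneRootConst`; `Δ = 16 c(θ)² D(θ)`, so this holds at every place
not dividing `2Δ` where the model is integral).

* `isSquare_valuation_sub_of_equation` — **`v(x − θ)` is a square in `Γ₀`** (even) for every `(x, y)` on
  the curve with `x ≠ θ`. Proof (Cassels' `Norm(x − Θ) = F(x) = □`, read locally): on the curve
  `(x − θ)·Q(x) = (2y + a₁x + a₃)²` with `Q(x) = 4x² + (4θ + b₂)x + (4θ² + b₂θ + 2b₄)`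
  (`mul_quadratic_eq_sq_of_equation`), and `Q(x) = 4c(θ) + (x − θ)(12θ + b₂ + 4(x − θ))`; if `v(x − θ) < 1`
  then `v(Q(x)) = v(4c(θ)) = 1` and `v(x − θ) = v(ỹ)²`; if `v(x − θ) > 1` then `v(x) = v(x − θ)`,
  `v(Q(x)) = v(x − θ)²` and `v(x − θ)³ = v(ỹ)²`, so `v(x − θ) = (v(ỹ)/v(x − θ))²`; else `v(x − θ) = 1`.
* `exists_isSquare_valuation_oneRootComponent` — every value of Cassels' map `oneRootComponent θ` on
  `E(L)` is the class of an `r ≠ 0` with `v(r)` a square (`O ↦ 1`, `T_θ ↦ c(θ)`).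
* `isSquare_valuation_of_res_mem`, `isSquare_valuation_of_mem_selmerGroup` — with the local bridge
  (`TwoDescentOneRootKummerBridgeLocal.lean`): a `2`-Selmer class `c ∈ Sel⁽²⁾(E/K)` whose global
  `θ`-component is `[a]`, `a ∈ Kˣ`, has `v(a)` a square at every such place of the `K`-field `E = K_v`;
* `isSquare_adicValuation_of_mem_selmerGroup` — the same at a finite place `𝔭` of a number field `K`
  with the hypotheses stated on `K` (`𝔭 ∤ 2`, `θ, b₂, b₄ ∈ 𝒪_𝔭`, `𝔭 ∤ c(θ)`): `v_𝔭(a)` is a square in `ℤₘ₀`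
  (i.e. `ord_𝔭(a)` is even);
* `isSquare_adicValuation_of_mem_selmerGroup_of_resTorsion` — the same for a curve over a subfield
  `k ⊂ K` and the cohomological Cassels map `Φ = kummerEquiv ∘ oneRootDescentH1 : H¹(k, E[2]) → Kˣ/Kˣ²`
  (`k = ℚ`, `K = ℚ(θ)`): `Φ(Sel⁽²⁾(E/k))` consists of classes unramified outside `2Δ∞` — the valuation half
  of "`Φ(Sel⁽²⁾) ⊆ K(S, 2)`".

Theorems only; no named fact, no `sorry`. Seat `bsd-line-spt-p1` (g29), milestone S5(i) of the `2`-Selmer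
upgrade of the kernel general `2`-descent.

## References

* [Cassels1991LecturesEllipticCurves] J. W. S. Cassels, *Lectures on Elliptic Curves*, LMSST 24, CUP 1991,
  §15 (p. 44: `μ(𝔊)` consists of units outside `2Δ` modulo squares; `Norm(a − Θ) = F(a)`).
* [SilvermanAEC2009] J. H. Silverman, *The Arithmetic of Elliptic Curves*, 2nd ed., GTM 106, Springer 2009,
  Prop. X.1.4 (image in `K(S, 2)`), Prop. X.4.9, Cor. X.4.4 (Selmer classes unramified outside `S`).
-/

noncomputable section

open scoped Classical

/-! ### The local computation: `v(x − θ)` is even at a good odd place -/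

namespace WeierstrassCurve.Affine

variable {L : Type*} [Field L] {Γ₀ : Type*} [LinearOrderedCommGroupWithZero Γ₀] (v : Valuation L Γ₀)
  {W : Affine L} {θ : L}

/-- `v(n) ≤ 1` for every natural number `n` (ultrametric inequality). [folklore] -/
private theorem val_natCast_le_one (n : ℕ) : v (n : L) ≤ 1 := by
  induction n with
  | zero => simp
  | succ n ih =>
    rw [Nat.cast_succ]
    exact (v.map_add _ _).trans (max_le ih (by rw [v.map_one]))

/-- **`v(x − θ)` is even at a good odd place** (Cassels §15, "units outside `2Δ`"; Silverman AEC X.1.4,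
`Sel ⊆ K(S, 2)`, for one rational root): with `v(2) = 1`, `θ, b₂, b₄` integral and `v(c(θ)) = 1`, every point
`(x, y)` of the curve with `x ≠ θ` has `v(x − θ)` a square in the value group.
[cite: Cassels1991LecturesEllipticCurves, §15 (p. 44)] [cite: SilvermanAEC2009, Prop. X.1.4] -/
theorem isSquare_valuation_sub_of_equation (h : W.IsTwoTorsionX θ) (hθ : v θ ≤ 1) (hb₂ : v W.b₂ ≤ 1)
    (hb₄ : v W.b₄ ≤ 1) (h2 : v 2 = 1) (hc : v (W.oneRootConst θ) = 1) {x y : L} (hxy : W.Equation x y)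
    (hx : x ≠ θ) : IsSquare (v (x - θ)) := by
  have h20 : (2 : L) ≠ 0 := fun h0 => by rw [h0, map_zero] at h2; exact zero_ne_one h2
  have h4 : v 4 = 1 := by rw [show (4 : L) = 2 * 2 by norm_num, map_mul, h2, one_mul]
  set d : L := x - θ with hd
  have hd0 : d ≠ 0 := sub_ne_zero.mpr hx
  have hvd0 : v d ≠ 0 := (Valuation.ne_zero_iff v).mpr hd0
  -- Cassels' square-norm relation, read locally: `(x − θ)·Q(x) = ỹ²`
  have key := mul_quadratic_eq_sq_of_equation h hxy
  set Q : L := 4 * x ^ 2 + (4 * θ + W.b₂) * x + (4 * θ ^ 2 + W.b₂ * θ + 2 * W.b₄) with hQ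
  have hvkey : v d * v Q = v (2 * y + W.a₁ * x + W.a₃) * v (2 * y + W.a₁ * x + W.a₃) := by
    rw [← map_mul, ← map_mul, ← sq, ← key]
  -- `Q(x) = 4c(θ) + d·(12θ + b₂ + 4d)`, `v(4c(θ)) = 1`
  have hQ₀ : (12 * θ ^ 2 + 2 * W.b₂ * θ + 2 * W.b₄ : L) = 4 * W.oneRootConst θ := by
    unfold oneRootConst
    field_simp
    ring
  have hvQ₀ : v (12 * θ ^ 2 + 2 * W.b₂ * θ + 2 * W.b₄) = 1 := by rw [hQ₀, map_mul, h4, hc, one_mul]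
  have hQsplit : Q = (12 * θ ^ 2 + 2 * W.b₂ * θ + 2 * W.b₄) + d * (12 * θ + W.b₂ + 4 * d) := by
    rw [hQ, hd]; ring
  rcases lt_trichotomy (v d) 1 with hlt | heq | hgt
  · -- `v(x − θ) < 1`: `Q(x)` is a unit, `v(x − θ) = v(ỹ)²`
    have hsmall : v (d * (12 * θ + W.b₂ + 4 * d)) < 1 := by
      rw [map_mul]
      have h1 : v (12 * θ + W.b₂ + 4 * d) ≤ 1 := by
        refine v.map_add_le (v.map_add_le ?_ hb₂) ?_
        · rw [map_mul]
          have h12 : v (12 : L) ≤ 1 := by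
            have := val_natCast_le_one v 12
            rwa [Nat.cast_ofNat] at this
          exact mul_le_one' h12 hθ
        · rw [map_mul, h4, one_mul]; exact hlt.le
      calc v d * v (12 * θ + W.b₂ + 4 * d) ≤ v d * 1 := mul_le_mul' le_rfl h1
        _ < 1 := by rw [mul_one]; exact hlt
    have hvQ : v Q = 1 := by
      rw [hQsplit, Valuation.map_add_eq_of_lt_left v (by rw [hvQ₀]; exact hsmall), hvQ₀]
    rw [hvQ, mul_one] at hvkey
    exact ⟨_, hvkey⟩
  · exact ⟨1, by rw [heq, mul_one]⟩
  · -- `v(x − θ) > 1`: `v(x) = v(x − θ)`, `v(Q(x)) = v(x − θ)²`, `v(x − θ)³ = v(ỹ)²`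
    have hvx : v x = v d := by
      have hx' : x = d + θ := by rw [hd]; ring
      rw [hx', Valuation.map_add_eq_of_lt_left v (lt_of_le_of_lt hθ hgt)]
    have hdd : v d < v d * v d := by
      have := mul_lt_mul_of_pos_right hgt (zero_lt_iff.mpr hvd0)
      rwa [one_mul] at this
    have h1dd : (1 : Γ₀) < v d * v d := hgt.trans hdd
    have hlead : v (4 * x ^ 2) = v d * v d := by rw [map_mul, h4, one_mul, map_pow, hvx, sq]
    have hrest : v ((4 * θ + W.b₂) * x + (4 * θ ^ 2 + W.b₂ * θ + 2 * W.b₄)) < v d * v d := by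
      refine v.map_add_lt ?_ ?_
      · rw [map_mul, hvx]
        have h1 : v (4 * θ + W.b₂) ≤ 1 :=
          v.map_add_le (by rw [map_mul, h4, one_mul]; exact hθ) hb₂
        calc v (4 * θ + W.b₂) * v d ≤ 1 * v d := mul_le_mul' h1 le_rfl
          _ < v d * v d := by rw [one_mul]; exact hdd
      · refine lt_of_le_of_lt ?_ h1dd
        refine v.map_add_le (v.map_add_le ?_ ?_) ?_
        · rw [map_mul, h4, one_mul, map_pow]; exact pow_le_one' hθ 2
        · rw [map_mul]; exact mul_le_one' hb₂ hθ
        · rw [map_mul, h2, one_mul]; exact hb₄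
    have hvQ : v Q = v d * v d := by
      have hQ' : Q = 4 * x ^ 2 + ((4 * θ + W.b₂) * x + (4 * θ ^ 2 + W.b₂ * θ + 2 * W.b₄)) := by
        rw [hQ]; ring
      rw [hQ', Valuation.map_add_eq_of_lt_left v (by rw [hlead]; exact hrest), hlead]
    rw [hvQ] at hvkey
    refine ⟨v (2 * y + W.a₁ * x + W.a₃) / v d, ?_⟩
    rw [div_mul_div_comm, eq_div_iff (mul_ne_zero hvd0 hvd0), hvkey]

/-- **Cassels' map takes "unit" values at a good odd place**: under the same hypotheses, for every
`P ∈ E(L)` the one-root component `oneRootComponent θ P ∈ Lˣ/Lˣ²` is the class of some `r ≠ 0` with `v(r)`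
a square (`O ↦ 1`; `T_θ ↦ c(θ)`, a unit; `(x, y) ↦ x − θ`).
[cite: Cassels1991LecturesEllipticCurves, §15 (p. 44)] [cite: SilvermanAEC2009, Prop. X.1.4] -/
theorem exists_isSquare_valuation_oneRootComponent (h : W.IsTwoTorsionX θ) (hθ : v θ ≤ 1)
    (hb₂ : v W.b₂ ≤ 1) (hb₄ : v W.b₄ ≤ 1) (h2 : v 2 = 1) (hc : v (W.oneRootConst θ) = 1) (P : W.Point) :
    ∃ r : L, r ≠ 0 ∧ Point.oneRootComponent W θ P = sqClass r ∧ IsSquare (v r) := by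
  rcases P with _ | ⟨x, y, hP⟩
  · refine ⟨1, one_ne_zero, ?_, ⟨1, by rw [map_one, mul_one]⟩⟩
    rw [← Point.zero_def, Point.oneRootComponent_zero]
    exact ((sqClass_eq_one_iff one_ne_zero).mpr ⟨1, by ring⟩).symm
  · by_cases hx : x = θ
    · have hc0 : W.oneRootConst θ ≠ 0 := fun h0 => by rw [h0, map_zero] at hc; exact zero_ne_one hc
      exact ⟨W.oneRootConst θ, hc0, Point.oneRootComponent_some_of_eq hP hx, ⟨1, by rw [hc, mul_one]⟩⟩
    · exact ⟨x - θ, sub_ne_zero.mpr hx, Point.oneRootComponent_some_of_ne hP hx,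
        isSquare_valuation_sub_of_equation v h hθ hb₂ hb₄ h2 hc hP.1 hx⟩

/-- **A square class of square valuation**: if `[u] = sqClass r` in `Lˣ/Lˣ²` with `v(r)` a square, then
`v(u)` is a square (`r = u s²`). [cite: SilvermanAEC2009, Prop. X.1.4] -/
theorem isSquare_valuation_of_mk_eq_sqClass {u : Lˣ} {r : L} (hr : r ≠ 0)
    (h : (QuotientGroup.mk u : SqUnits L) = sqClass r) (hsq : IsSquare (v r)) : IsSquare (v (u : L)) := by
  rw [sqClass_of_ne_zero hr, QuotientGroup.eq] at h
  obtain ⟨s, hs⟩ := h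
  have hr' : r = (u : L) * ((s : L) ^ 2) := by
    have := congrArg Units.val hs
    rw [powMonoidHom_apply, Units.val_pow_eq_pow_val, Units.val_mul, Units.val_inv_eq_inv_val,
      Units.val_mk0] at this
    rw [this]
    field_simp
  have hvs0 : v (s : L) ≠ 0 := (Valuation.ne_zero_iff v).mpr s.ne_zero
  obtain ⟨t, ht⟩ := hsq
  rw [hr', map_mul, map_pow] at ht
  refine ⟨t / v (s : L), ?_⟩
  rw [div_mul_div_comm, eq_div_iff (mul_ne_zero hvs0 hvs0), ← ht, sq]

end WeierstrassCurve.Affine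

/-! ### Selmer classes: square valuation at the good odd places -/

namespace WeierstrassCurve

open Literature.NumberTheory.GaloisRepresentations Literature.NumberTheory.EllipticCurves Field
open WeierstrassCurve.Affine

universe u

variable {K : Type u} [Field K] [CharZero K] (W : WeierstrassCurve K) [W.IsElliptic] {θ : K}
variable (E : Type u) [Field E] [Algebra K E] [CharZero E] {Γ₀ : Type*} [LinearOrderedCommGroupWithZero Γ₀]

omit [CharZero K] [W.IsElliptic] [CharZero E] in
/-- Cassels' constant of the base change is the image of Cassels' constant: `c_{W⁄E}(ι θ) = ι(c_W(θ))`.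
[cite: Cassels1991LecturesEllipticCurves, §15 (iii)] -/
theorem oneRootConst_baseChange (θ : K) :
    (W.baseChange E).toAffine.oneRootConst (algebraMap K E θ) = algebraMap K E (W.toAffine.oneRootConst θ) := by
  simp only [Affine.oneRootConst, baseChange, map_b₂, map_b₄, map_add, map_mul, map_div₀, map_pow,
    map_ofNat]

/-- **Selmer-type classes have square valuation at a good odd place** (one rational root): let `𝔳` be a
valuation of the `K`-field `E` with `𝔳(2) = 1`, `θ, b₂, b₄` `𝔳`-integral and `𝔳(c(θ)) = 1`. If
`c ∈ H¹(K, E[2])` has `res_E c` in the local Kummer condition and global `θ`-component `[a]`, `a ∈ Kˣ`,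
then `𝔳(a)` is a square. [cite: SilvermanAEC2009, Prop. X.1.4, Prop. X.4.9]
[cite: Cassels1991LecturesEllipticCurves, §15 (p. 44)] -/
theorem isSquare_valuation_of_res_mem (𝔳 : Valuation E Γ₀) (h : W.toAffine.IsTwoTorsionX θ)
    [(W.baseChange E).IsElliptic]
    (h2 : 𝔳 2 = 1) (hθ : 𝔳 (algebraMap K E θ) ≤ 1) (hb₂ : 𝔳 (algebraMap K E W.b₂) ≤ 1)
    (hb₄ : 𝔳 (algebraMap K E W.b₄) ≤ 1) (hc : 𝔳 (algebraMap K E (W.toAffine.oneRootConst θ)) = 1)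
    {c : galH1Torsion W 2}
    (hres : galoisCohomology.res (W.torsionGaloisModule 2) E 1 c ∈ W.kummerLocalConditionAt 2 E)
    (a : Kˣ) (ha : kummerEquiv K 2 (W.oneRootCharH1 h c) = Additive.ofMul (QuotientGroup.mk a)) :
    IsSquare (𝔳 (algebraMap K E (a : K))) := by
  obtain ⟨P, hP⟩ := W.exists_oneRootComponent_eq_of_res_mem E h hres a ha
  have hb₂' : 𝔳 (W.baseChange E).toAffine.b₂ ≤ 1 := by
    have : (W.baseChange E).toAffine.b₂ = algebraMap K E W.b₂ := by simp only [baseChange, map_b₂]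
    rw [this]; exact hb₂
  have hb₄' : 𝔳 (W.baseChange E).toAffine.b₄ ≤ 1 := by
    have : (W.baseChange E).toAffine.b₄ = algebraMap K E W.b₄ := by simp only [baseChange, map_b₄]
    rw [this]; exact hb₄
  have hc' : 𝔳 ((W.baseChange E).toAffine.oneRootConst (algebraMap K E θ)) = 1 := by
    rw [oneRootConst_baseChange]; exact hc
  obtain ⟨r, hr, hPr, hsq⟩ := exists_isSquare_valuation_oneRootComponent 𝔳
    (W.isTwoTorsionX_baseChange h E) hθ hb₂' hb₄' h2 hc' P
  have hmk : (QuotientGroup.mk (Units.map (algebraMap K E : K →* E) a) : SqUnits E) = sqClass r := by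
    rw [← hP, hPr]
  have := isSquare_valuation_of_mk_eq_sqClass 𝔳 hr hmk hsq
  rwa [Units.coe_map, MonoidHom.coe_coe] at this

/-- **Selmer classes have square valuation at the good odd places** (number field `K`, place `v`, a
valuation `𝔳` of `K_v` with the good odd hypotheses): for `c ∈ Sel⁽²⁾(E/K)` with global `θ`-component
`[a]`, `𝔳(a)` is a square. [cite: SilvermanAEC2009, Prop. X.1.4, Prop. X.4.9] -/
theorem isSquare_valuation_of_mem_selmerGroup [NumberField K] (h : W.toAffine.IsTwoTorsionX θ)
    {c : galH1Torsion W 2} (hc : c ∈ selmerGroup W 2) (v : NumberField.Place K)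
    [CharZero (NumberField.Place.Completion v)]
    [(W.baseChange (NumberField.Place.Completion v)).IsElliptic]
    (𝔳 : Valuation (NumberField.Place.Completion v) Γ₀) (h2 : 𝔳 2 = 1)
    (hθ : 𝔳 (algebraMap K (NumberField.Place.Completion v) θ) ≤ 1)
    (hb₂ : 𝔳 (algebraMap K (NumberField.Place.Completion v) W.b₂) ≤ 1)
    (hb₄ : 𝔳 (algebraMap K (NumberField.Place.Completion v) W.b₄) ≤ 1)
    (hcθ : 𝔳 (algebraMap K (NumberField.Place.Completion v) (W.toAffine.oneRootConst θ)) = 1)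
    (a : Kˣ) (ha : kummerEquiv K 2 (W.oneRootCharH1 h c) = Additive.ofMul (QuotientGroup.mk a)) :
    IsSquare (𝔳 (algebraMap K (NumberField.Place.Completion v) (a : K))) :=
  W.isSquare_valuation_of_res_mem (NumberField.Place.Completion v) 𝔳 h h2 hθ hb₂ hb₄ hcθ
    ((W.mem_selmerGroup_iff_forall_localization_mem 2 c).mp hc v) a ha

/-! ### Finite places of a number field: `ord_𝔭(a)` is even -/

open IsDedekindDomain NumberField

/-- **`ord_𝔭(a)` is even for a `2`-Selmer class at a good odd prime `𝔭`** (Cassels §15: `μ(Sel) ⊆` units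
outside `2Δ` mod squares; one rational root): for a number field `K`, `c ∈ Sel⁽²⁾(E/K)` with global
`θ`-component `[a]`, `a ∈ Kˣ`, and a prime `𝔭` of `𝒪_K` with `𝔭 ∤ 2`, `θ, b₂, b₄ ∈ 𝒪_{K,𝔭}` and
`𝔭 ∤ c(θ) = 3θ² + (b₂/2)θ + b₄/2`, the `𝔭`-adic valuation `v_𝔭(a) ∈ ℤₘ₀` is a square, i.e. `ord_𝔭(a)` is
even. [cite: Cassels1991LecturesEllipticCurves, §15 (p. 44)] [cite: SilvermanAEC2009, Prop. X.1.4, Cor. X.4.4] -/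
theorem isSquare_adicValuation_of_mem_selmerGroup [NumberField K] (h : W.toAffine.IsTwoTorsionX θ)
    {c : galH1Torsion W 2} (hc : c ∈ selmerGroup W 2) (𝔭 : HeightOneSpectrum (𝓞 K))
    (h2 : 𝔭.valuation K 2 = 1) (hθ : 𝔭.valuation K θ ≤ 1) (hb₂ : 𝔭.valuation K W.b₂ ≤ 1)
    (hb₄ : 𝔭.valuation K W.b₄ ≤ 1) (hcθ : 𝔭.valuation K (W.toAffine.oneRootConst θ) = 1)
    (a : Kˣ) (ha : kummerEquiv K 2 (W.oneRootCharH1 h c) = Additive.ofMul (QuotientGroup.mk a)) :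
    IsSquare (𝔭.valuation K (a : K)) := by
  haveI : CharZero (Place.Completion (Sum.inr 𝔭 : Place K)) :=
    charZero_of_injective_algebraMap (algebraMap K (𝔭.adicCompletion K)).injective
  haveI : (W.baseChange (Place.Completion (Sum.inr 𝔭 : Place K))).IsElliptic := W.isElliptic_baseChange _
  set 𝔳 : Valuation (Place.Completion (Sum.inr 𝔭 : Place K)) (WithZero (Multiplicative ℤ)) :=
    (Valued.v : Valuation (𝔭.adicCompletion K) (WithZero (Multiplicative ℤ))) with h𝔳
  have hval : ∀ x : K, 𝔳 (algebraMap K (Place.Completion (Sum.inr 𝔭 : Place K)) x) = 𝔭.valuation K x :=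
    fun x => HeightOneSpectrum.valuedAdicCompletion_eq_valuation' 𝔭 x
  have key := W.isSquare_valuation_of_mem_selmerGroup h hc (Sum.inr 𝔭 : Place K) 𝔳
    (by rw [show (2 : Place.Completion (Sum.inr 𝔭 : Place K)) = algebraMap K _ 2 from (map_ofNat _ 2).symm,
      hval]; exact h2)
    (by rw [hval]; exact hθ) (by rw [hval]; exact hb₂) (by rw [hval]; exact hb₄) (by rw [hval]; exact hcθ) a ha
  rwa [hval] at key

/-- **The cohomological Cassels map of a curve over a subfield is unramified outside `2Δ` on Selmer classes.**
Let `E/k` be an elliptic curve, `K/k` number fields with a root `θ ∈ K` of the `2`-division cubic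
(`k = ℚ`, `K = ℚ(θ)`), `Φ = kummerEquiv K 2 ∘ oneRootDescentH1 K hθ : H¹(k, E[2]) → Kˣ/Kˣ²`. For
`c ∈ Sel⁽²⁾(E/k)` with `Φ(c) = [a]`, `a ∈ Kˣ`, and a prime `𝔭` of `K` with `𝔭 ∤ 2`, `θ, b₂, b₄ ∈ 𝒪_{K,𝔭}`,
`𝔭 ∤ c(θ)`: `ord_𝔭(a)` is even. [cite: Cassels1991LecturesEllipticCurves, §15 (p. 44)]
[cite: SilvermanAEC2009, Prop. X.1.4, Cor. X.4.4] -/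
theorem isSquare_adicValuation_of_mem_selmerGroup_of_resTorsion
    {k : Type u} [Field k] [NumberField k] (V : WeierstrassCurve k) [V.IsElliptic]
    [Algebra k K] [NumberField K] [(V.baseChange K).IsElliptic]
    (hθ : (V.baseChange K).toAffine.IsTwoTorsionX θ) {c : galH1Torsion V 2} (hc : c ∈ selmerGroup V 2)
    (𝔭 : HeightOneSpectrum (𝓞 K)) (h2 : 𝔭.valuation K 2 = 1) (hθ𝔭 : 𝔭.valuation K θ ≤ 1)
    (hb₂ : 𝔭.valuation K (V.baseChange K).b₂ ≤ 1) (hb₄ : 𝔭.valuation K (V.baseChange K).b₄ ≤ 1)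
    (hcθ : 𝔭.valuation K ((V.baseChange K).toAffine.oneRootConst θ) = 1)
    (a : Kˣ) (ha : kummerEquiv K 2 (V.oneRootDescentH1 K hθ c) = Additive.ofMul (QuotientGroup.mk a)) :
    IsSquare (𝔭.valuation K (a : K)) := by
  rw [oneRootDescentH1_apply] at ha
  exact (V.baseChange K).isSquare_adicValuation_of_mem_selmerGroup hθ (resTorsion_mem_selmerGroup V K 2 hc)
    𝔭 h2 hθ𝔭 hb₂ hb₄ hcθ a ha

end WeierstrassCurve

end
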